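import Literature.Analysis.FunctionSpaces.SchauderCompactSupport
import Literature.Analysis.FunctionSpaces.ContDiffHolderLocalization
import HarnessLib

/-!
# Tools for the interior Schauder estimate on balls: Hölder bookkeeping on a set and cut-offs

Topic `Literature/Analysis/PDE`. Auxiliary lemmas for
`Literature.Analysis.PDE.exists_schauder_interior_ball` (Gilbarg–Trudinger 2001, Thm. 6.2 /
Cor. 6.3 on concentric balls), which is derived from the tree's compact-support estimate
`Literature.Analysis.FunctionSpaces.exists_schauder_compact_support` by multiplying a function
`v`, smooth only on an open ball, by a smooth cut-off `χ` supported inside the ball: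

* `holderOnWith_of_dist_le_rpow` — `HolderOnWith` from the real Hölder inequality on a set;
* `holderOnWith_clm_apply` — evaluating a Hölder-on family of linear maps at a short vector;
* `holderOnWith_of_dist_le_mul_of_norm_le` — Lipschitz and bounded on a set implies `r`-Hölder
  on the set (`r ≤ 1`), constant `B + 2M`;
* `holderOnWith_of_norm_fderiv_le` — the same from a derivative bound on a convex set;
* `norm_mul_le_of_eq_zero` — sup bound of a product one of whose factors vanishes off a set;
* `contDiff_infty_mul_of_tsupport_subset`, `hasCompactSupport_and_tsupport_mul_subset` —
  `χ v` is globally smooth with compact support;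
* `fderiv_cutoff_mul_eq_and_iteratedFDeriv_two_cutoff_mul_eq` — the Leibniz formulas for
  `D(χ v)(e)` and `D²(χ v)(e, e')` in terms of the derivatives of `v`, valid at EVERY point
  (outside the support of `χ` both sides vanish), although `v` is smooth only on an open set
  containing the support of `χ`.

Everything is proved; no named facts.

## References

* D. Gilbarg, N. S. Trudinger, *Elliptic Partial Differential Equations of Second Order* (2001),
  §6.1. [GilbargTrudinger2001]
-/

noncomputable section

open Filter Function Metric Set
open scoped NNReal ContDiff Topology
open Literature.Analysis.FunctionSpaces

namespace Literature.Analysis.PDE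

/-! ### Hölder bookkeeping on a set -/

section Holder

variable {X Y : Type*} [PseudoMetricSpace X] [PseudoMetricSpace Y]

/-- **`HolderOnWith` from the real Hölder inequality on a set**:
`dist (f x) (f y) ≤ C dist x y ^ r` for `x, y ∈ s`. [folklore] -/
theorem holderOnWith_of_dist_le_rpow {C r : ℝ≥0} {f : X → Y} {s : Set X}
    (h : ∀ x ∈ s, ∀ y ∈ s, dist (f x) (f y) ≤ C * dist x y ^ (r : ℝ)) :
    HolderOnWith C r f s := by
  intro x hx y hy
  rw [edist_dist, edist_dist, ENNReal.ofReal_rpow_of_nonneg dist_nonneg r.coe_nonneg,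
    ← ENNReal.ofReal_coe_nnreal, ← ENNReal.ofReal_mul C.coe_nonneg]
  exact ENNReal.ofReal_le_ofReal (h x hx y hy)

variable {E : Type*} [NormedAddCommGroup E] [NormedSpace ℝ E] {F : Type*} [NormedAddCommGroup F]
  [NormedSpace ℝ F]

omit [NormedSpace ℝ E] in
/-- Evaluating an `r`-Hölder-on-`s` family of continuous linear maps at a vector of norm `≤ 1`
gives an `r`-Hölder-on-`s` function with the same constant. [folklore] -/
theorem holderOnWith_clm_apply [NormedSpace ℝ E] {D : E → E →L[ℝ] F} {C r : ℝ≥0} {s : Set E}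
    (hD : HolderOnWith C r D s) {v : E} (hv : ‖v‖ ≤ 1) :
    HolderOnWith C r (fun x => D x v) s := by
  refine holderOnWith_of_dist_le_rpow fun x hx y hy => ?_
  calc dist (D x v) (D y v) = ‖(D x - D y) v‖ := by
        rw [dist_eq_norm, _root_.sub_apply]
    _ ≤ ‖D x - D y‖ * 1 := (D x - D y).le_opNorm_of_le hv
    _ = dist (D x) (D y) := by rw [mul_one, dist_eq_norm]
    _ ≤ C * dist x y ^ (r : ℝ) := hD.dist_le hx hy

omit [NormedSpace ℝ E] [NormedSpace ℝ F] in
/-- Lipschitz and bounded on a set implies `r`-Hölder on the set for `r ≤ 1`, with constant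
`B + 2M` (set version of the tree's `holderWith_of_dist_le_mul_of_norm_le`). [folklore] -/
theorem holderOnWith_of_dist_le_mul_of_norm_le {φ : E → F} {s : Set E} {B M r : ℝ≥0}
    (hr : r ≤ 1) (hL : ∀ x ∈ s, ∀ y ∈ s, dist (φ x) (φ y) ≤ B * dist x y)
    (hM : ∀ x ∈ s, ‖φ x‖ ≤ M) : HolderOnWith (B + 2 * M) r φ s := by
  refine holderOnWith_of_dist_le_rpow fun x hx y hy => ?_
  have hr' : (r : ℝ) ≤ 1 := by exact_mod_cast hr
  push_cast
  by_cases hd : dist x y ≤ 1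
  · have h1 : dist x y ≤ dist x y ^ (r : ℝ) := by
      conv_lhs => rw [← Real.rpow_one (dist x y)]
      exact Real.rpow_le_rpow_of_exponent_ge' dist_nonneg hd r.coe_nonneg hr'
    calc dist (φ x) (φ y) ≤ B * dist x y := hL x hx y hy
      _ ≤ B * dist x y ^ (r : ℝ) := by gcongr
      _ ≤ (B + 2 * M) * dist x y ^ (r : ℝ) := by gcongr; linarith [M.coe_nonneg]
  · push Not at hd
    have h1 : (1 : ℝ) ≤ dist x y ^ (r : ℝ) := Real.one_le_rpow hd.le r.coe_nonneg
    calc dist (φ x) (φ y) ≤ ‖φ x‖ + ‖φ y‖ := dist_le_norm_add_norm _ _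
      _ ≤ M + M := add_le_add (hM x hx) (hM y hy)
      _ = 2 * M * 1 := by ring
      _ ≤ (B + 2 * M) * dist x y ^ (r : ℝ) := by gcongr; linarith [B.coe_nonneg]

/-- **Mean value plus boundedness**: on a convex set, `‖Dφ‖ ≤ B` and `‖φ‖ ≤ B` give the
`r`-Hölder bound with constant `B + 2B` (`r ≤ 1`). [folklore] -/
theorem holderOnWith_of_norm_fderiv_le {φ : E → F} {s : Set E} (hs : Convex ℝ s) {B r : ℝ≥0}
    (hr : r ≤ 1) (hφ : ∀ x ∈ s, DifferentiableAt ℝ φ x) (hB : ∀ x ∈ s, ‖fderiv ℝ φ x‖ ≤ B)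
    (hM : ∀ x ∈ s, ‖φ x‖ ≤ B) : HolderOnWith (B + 2 * B) r φ s := by
  refine holderOnWith_of_dist_le_mul_of_norm_le hr (fun x hx y hy => ?_) hM
  rw [dist_eq_norm, dist_eq_norm]
  exact hs.norm_image_sub_le_of_norm_fderiv_le hφ hB hy hx

/-- Sup bound of a product `g h` with `h` vanishing off `s`: only the bound of `g` ON `s`
enters. [folklore] -/
theorem norm_mul_le_of_eq_zero {T : Type*} {g h : T → ℝ} {s : Set T} {Gs Hs : ℝ≥0}
    (hg : ∀ x ∈ s, ‖g x‖ ≤ Gs) (hhs : ∀ x, ‖h x‖ ≤ Hs) (hz : ∀ x ∉ s, h x = 0) (x : T) :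
    ‖g x * h x‖ ≤ Gs * Hs := by
  by_cases hx : x ∈ s
  · rw [norm_mul]
    exact mul_le_mul (hg x hx) (hhs x) (norm_nonneg _) Gs.coe_nonneg
  · rw [hz x hx, mul_zero, norm_zero]
    positivity

end Holder

/-! ### Cut-off products with a function smooth on an open set -/

section Cutoff

variable {E : Type*} [NormedAddCommGroup E] [NormedSpace ℝ E]

/-- `χ v` is globally `C^∞` when `χ ∈ C^∞` has support inside an open set on which `v` is
`C^∞` (the `smul_eq_mul` form of the tree's `ContDiff.smul_of_contDiffOn`; the same statement as
`Literature.Analysis.FluidPDE.contDiff_mul_of_contDiffOn_of_tsupport_subset`, kept here as a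
two-line corollary so as not to import the heat-kernel files). [folklore] -/
theorem contDiff_infty_mul_of_tsupport_subset {χ v : E → ℝ} {U : Set E} (hχ : ContDiff ℝ ∞ χ)
    (hU : IsOpen U) (hv : ContDiffOn ℝ ∞ v U) (hχU : tsupport χ ⊆ U) :
    ContDiff ℝ ∞ fun y => χ y * v y := by
  have h := ContDiff.smul_of_contDiffOn hχ hU hv hχU
  simpa only [smul_eq_mul] using h

omit [NormedSpace ℝ E] in
/-- `χ v` has compact support inside `K` when `tsupport χ ⊆ K`, `K` compact. [folklore] -/
theorem hasCompactSupport_and_tsupport_mul_subset {χ : E → ℝ} (v : E → ℝ) {K : Set E}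
    (hK : IsCompact K) (hχK : tsupport χ ⊆ K) :
    HasCompactSupport (fun y => χ y * v y) ∧ tsupport (fun y => χ y * v y) ⊆ K :=
  have hχc : HasCompactSupport χ := hK.of_isClosed_subset (isClosed_tsupport _) hχK
  ⟨hχc.mul_right, tsupport_mul_subset_left.trans hχK⟩

variable [FiniteDimensional ℝ E]

/-- **Leibniz formulas for a cut-off product, valid everywhere.** For `v` of class `C^∞` on an
open set `U`, a compact `K ⊆ U` and a `C^∞` cut-off `χ` with `tsupport χ ⊆ K`, at every point
`D(χ v)(e) = Dv(e) χ + v Dχ(e)` and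
`D²(χ v)(e, e') = D²v(e, e') χ + (Dv(e') Dχ(e) + Dv(e) Dχ(e') + v D²χ(e, e'))`
(off `K` both sides vanish; near `K` one replaces `v` by a compactly supported smooth
modification `ψ v`, `ψ = 1` near `K`, and uses the global Leibniz rule). [folklore] -/
theorem fderiv_cutoff_mul_eq_and_iteratedFDeriv_two_cutoff_mul_eq {χ v : E → ℝ} {U K : Set E}
    (hχ : ContDiff ℝ ∞ χ) (hU : IsOpen U) (hv : ContDiffOn ℝ ∞ v U) (hK : IsCompact K)
    (hKU : K ⊆ U) (hχK : tsupport χ ⊆ K) :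
    (∀ x e, fderiv ℝ (fun y => χ y * v y) x e = fderiv ℝ v x e * χ x + v x * fderiv ℝ χ x e) ∧
    ∀ x e e', iteratedFDeriv ℝ 2 (fun y => χ y * v y) x ![e, e'] =
      iteratedFDeriv ℝ 2 v x ![e, e'] * χ x + (fderiv ℝ v x e' * fderiv ℝ χ x e +
        fderiv ℝ v x e * fderiv ℝ χ x e' + v x * iteratedFDeriv ℝ 2 χ x ![e, e']) := by
  -- a second cut-off `ψ = 1` near `K` and the modification `ψ v`
  obtain ⟨ψ, hψ, -, hψU, hψ1, -⟩ := exists_contDiff_one_nhdsSet_of_isCompact hK hU hKU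
  have hvt : ContDiff ℝ ∞ fun y => ψ y * v y := contDiff_infty_mul_of_tsupport_subset hψ hU hv hψU
  have h2top : ((2 : ℕ) : WithTop ℕ∞) ≤ ((⊤ : ℕ∞) : WithTop ℕ∞) := WithTop.coe_le_coe.mpr le_top
  have hvt2 : ContDiff ℝ 2 fun y => ψ y * v y := hvt.of_le (by exact_mod_cast h2top)
  have hχ2 : ContDiff ℝ 2 χ := hχ.of_le (by exact_mod_cast h2top)
  have hvtd : Differentiable ℝ fun y => ψ y * v y := hvt2.differentiable (by norm_num)
  have hχd : Differentiable ℝ χ := hχ2.differentiable (by norm_num)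
  -- `χ v = χ (ψ v)` everywhere
  have hw_eq : (fun y => χ y * v y) = fun y => χ y * (ψ y * v y) := by
    funext y
    by_cases hy : χ y = 0
    · simp [hy]
    · have hyK : y ∈ K := hχK (subset_closure (mem_support.2 hy))
      rw [hψ1.self_of_nhdsSet y hyK, one_mul]
  -- `ψ v = v` near every point of `K`
  have hev : ∀ x ∈ K, (fun y => ψ y * v y) =ᶠ[𝓝 x] v := fun x hx => by
    filter_upwards [hψ1.filter_mono (nhds_le_nhdsSet hx)] with y hy
    rw [hy, one_mul]
  -- vanishing off `K`
  have hsupp : tsupport (fun y => χ y * v y) ⊆ K := tsupport_mul_subset_left.trans hχK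
  have hz0 : ∀ x ∉ K, χ x = 0 := fun x hx => image_eq_zero_of_notMem_tsupport fun h => hx (hχK h)
  have hz1 : ∀ x ∉ K, fderiv ℝ χ x = 0 := fun x hx =>
    fderiv_of_notMem_tsupport ℝ fun h => hx (hχK h)
  have hz2 : ∀ x ∉ K, iteratedFDeriv ℝ 2 χ x = 0 := fun x hx =>
    image_eq_zero_of_notMem_tsupport fun h => hx (hχK (tsupport_iteratedFDeriv_subset 2 h))
  have hzw1 : ∀ x ∉ K, fderiv ℝ (fun y => χ y * v y) x = 0 := fun x hx =>
    fderiv_of_notMem_tsupport ℝ fun h => hx (hsupp h)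
  have hzw2 : ∀ x ∉ K, iteratedFDeriv ℝ 2 (fun y => χ y * v y) x = 0 := fun x hx =>
    image_eq_zero_of_notMem_tsupport fun h => hx (hsupp (tsupport_iteratedFDeriv_subset 2 h))
  refine ⟨fun x e => ?_, fun x e e' => ?_⟩
  · by_cases hx : x ∈ K
    · rw [hw_eq, fderiv_mul_apply_eq hχd hvtd x e, (hev x hx).fderiv_eq, (hev x hx).eq_of_nhds]
      ring
    · rw [hzw1 x hx, hz1 x hx, hz0 x hx]
      simp
  · by_cases hx : x ∈ K
    · rw [hw_eq, iteratedFDeriv_two_mul_apply_eq hχ2 hvt2 x e e', (hev x hx).fderiv_eq,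
        ((hev x hx).iteratedFDeriv ℝ 2).eq_of_nhds, (hev x hx).eq_of_nhds]
      ring
    · rw [hzw2 x hx, hz2 x hx, hz1 x hx, hz0 x hx]
      simp

end Cutoff

end Literature.Analysis.PDE
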